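import Mathlib.CategoryTheory.Equivalence
import Literature.AlgebraicGeometry.Frobenioids.BaseCategoryTheoreticityDefs
import HarnessLib

/-!
# Frobenioids I, §3: Theorem 3.4 (Category-theoreticity of the base and Frobenius degree),
# Remark 3.4.1, Proposition 3.11

Mochizuki, *The geometry of Frobenioids I: the general theory*, Kyushu J. Math. **62** (2008)
293–400, kurims text pp. 62–63 (Thm. 3.4), p. 69 (Rem. 3.4.1), pp. 73–74 (Prop. 3.11)
[cite: MochizukiFrdI2008, Thm. 3.4 pp.62-63]. Theorem 3.4 is cited 8 times in IUT I–IV.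

Setting (p. 62): for `i = 1, 2`, `Φ_i` a divisorial monoid on a connected, totally epimorphic category
`D_i`, `C_i → F_{Φ_i}` a Frobenioid, `Ψ : C₁ ⥤ C₂` an equivalence of categories. As in the companion
file, `S_i : PreFrobenioidData C_i D_i` are the operations (INTERFACE, `TODO-merge: abc-iut-found`) and
each sub-item is a *conclusion predicate* in `S₁, S₂, Ψ`; the paper asserts it for all Frobenioids
(the named fact is the wrapper `∀ Frobenioids, …` once Def. 1.3 lands). "Some quasi-inverse to `Ψ`
preserves base-isomorphisms" is rendered with the chosen quasi-inverse `Ψ.inverse` (any two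
quasi-inverses are isomorphic, and a class of arrows stable under composition with isomorphisms is
preserved by one iff by the other). Functors the paper takes from elsewhere enter as parameters with
their locator: the isotropification functors `C_i → C_i^istr` of Prop. 1.9 (v) (seat abc-iut-L1-t1),
the perfections `C_i → C_i^pf` (`PerfectionData`, Def. 3.1 (iii) / Prop. 1.10 (i)).

Contents: Thm. 3.4 (i) (two decls: preservation; the `Ψ^istr` square with rigidity), (ii), (iii) (two
decls: preservation and `Ψ^{N_{≥1}}`; the `Ψ^pf` square), (iv) (two decls), (v); Rem. 3.4.1;
Prop. 3.11 (i), (ii), (iii). No statement of the paper is strengthened.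
-/

namespace Literature.AlgebraicGeometry.Frobenioids

open CategoryTheory

universe w₁ w₂ v₁ v₁' v₂ v₂' u₁ u₁' u₂ u₂'

variable {C₁ : Type u₁} [Category.{v₁} C₁] {D₁ : Type u₁'} [Category.{v₁'} D₁]
variable {C₂ : Type u₂} [Category.{v₂} C₂] {D₂ : Type u₂'} [Category.{v₂'} D₂]
variable (S₁ : PreFrobenioidData.{w₁} C₁ D₁) (S₂ : PreFrobenioidData.{w₂} C₂ D₂) (Ψ : C₁ ≌ C₂)

namespace PreFrobenioidData

/-! ### Recurring hypotheses and conclusions -/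

/-- Hypothesis (b) of Thm. 3.4 (iii)–(v) and of Cor. 4.11/4.12: "if `C₁, C₂` are of group-like type,
then both `Ψ` and some quasi-inverse to `Ψ` preserve base-isomorphisms" (FrdI p. 62).
[cite: MochizukiFrdI2008, Thm. 3.4 (iii) p.62] -/
def HypB : Prop :=
  S₁.IsOfGroupLikeType → S₂.IsOfGroupLikeType →
    PreservesMor Ψ.functor S₁.IsBaseIso S₂.IsBaseIso ∧ PreservesMor Ψ.inverse S₂.IsBaseIso S₁.IsBaseIso

/-- "`Ψ` preserves Frobenius degrees" / "`Ψ^{N_{≥1}}` is the identity" (FrdI Thm. 3.4 (iii), (iv) pp. 62–63).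
[cite: MochizukiFrdI2008, Thm. 3.4 (iv) p.63] -/
def PreservesDegFr : Prop := ∀ ⦃A B : C₁⦄ (φ : A ⟶ B), S₂.degFr (Ψ.functor.map φ) = S₁.degFr φ

/-- A `1`-commutative square `Ψ' ∘ L = R ∘ Ψ` of functors that is `1`-unique: `Ψ'` is an equivalence,
the square `1`-commutes, and any other `Ψ''` making it `1`-commute is isomorphic to `Ψ'` (the recurring
shape "there exists a `1`-unique functor … that fits into a `1`-commutative diagram … [the horizontal
arrows are equivalences]", FrdI §0 p. 15, Thm. 3.4 p. 62). [cite: MochizukiFrdI2008, Thm. 3.4 (i) p.62] -/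
def OneUniqueSquare {X₁ : Type*} [Category X₁] {X₂ : Type*} [Category X₂] {Y₁ : Type*} [Category Y₁]
    {Y₂ : Type*} [Category Y₂] (T : X₁ ⥤ X₂) (L : X₁ ⥤ Y₁) (R : X₂ ⥤ Y₂) (B : Y₁ ⥤ Y₂) : Prop :=
  B.IsEquivalence ∧ OneCommutes T R L B ∧ ∀ B' : Y₁ ⥤ Y₂, OneCommutes T R L B' → Nonempty (B' ≅ B)

/-! ### Theorem 3.4 -/

/-- **Theorem 3.4 (i)**, preservation part: if `C₁, C₂` are of quasi-isotropic type, `Ψ` preserves the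
isotropic objects, isotropic hulls and isometric pre-steps (FrdI p. 62). [cite: MochizukiFrdI2008, Thm. 3.4 (i) p.62] -/
def Thm34i : Prop :=
  S₁.IsOfQuasiIsotropicType → S₂.IsOfQuasiIsotropicType →
    PreservesObj Ψ.functor S₁.IsIsotropic S₂.IsIsotropic ∧
      PreservesMor Ψ.functor S₁.IsIsotropicHull S₂.IsIsotropicHull ∧
      PreservesMor Ψ.functor S₁.IsIsometricPreStep S₂.IsIsometricPreStep

/-- **Theorem 3.4 (i)**, diagram part: there is a `1`-unique `Ψ^istr : C₁^istr ⥤ C₂^istr` with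
`Ψ^istr ∘ istr₁ ≅ istr₂ ∘ Ψ` (`1`-commutative), the vertical arrows `istr_i : C_i → C_i^istr` being the
isotropification functors of Prop. 1.9 (v) (parameters here; seat abc-iut-L1-t1); and if `D₁, D₂` are slim
and `C₁, C₂` of Frobenius-normalized type, the composite functors of the square are rigid (FrdI p. 62).
[cite: MochizukiFrdI2008, Thm. 3.4 (i) p.62] -/
def Thm34i_istr (istr₁ : C₁ ⥤ S₁.Istr) (istr₂ : C₂ ⥤ S₂.Istr) : Prop :=
  S₁.IsOfQuasiIsotropicType → S₂.IsOfQuasiIsotropicType →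
    ∃ Ψistr : S₁.Istr ⥤ S₂.Istr, OneUniqueSquare Ψ.functor istr₁ istr₂ Ψistr ∧
      (IsSlim D₁ → IsSlim D₂ → S₁.IsOfFrobeniusNormalizedType → S₂.IsOfFrobeniusNormalizedType →
        IsRigidFunctor (Ψ.functor ⋙ istr₂) ∧ IsRigidFunctor (istr₁ ⋙ Ψistr))

/-- **Theorem 3.4 (ii)**: if `C₁, C₂` are of quasi-isotropic type and `D₁, D₂` of FSMFF-type, `Ψ`
preserves pre-steps, co-angular pre-steps and group-like objects (FrdI p. 62).
[cite: MochizukiFrdI2008, Thm. 3.4 (ii) p.62] -/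
def Thm34ii : Prop :=
  S₁.IsOfQuasiIsotropicType → S₂.IsOfQuasiIsotropicType → IsOfFSMFFType D₁ → IsOfFSMFFType D₂ →
    PreservesMor Ψ.functor S₁.IsPreStep S₂.IsPreStep ∧
      PreservesMor Ψ.functor S₁.IsCoAngularPreStep S₂.IsCoAngularPreStep ∧
      PreservesObj Ψ.functor S₁.IsGroupLikeObj S₂.IsGroupLikeObj

/-- **Theorem 3.4 (iii)**, preservation and Frobenius degrees: under (a) `C₁, C₂` of standard type and
(b) `HypB`, `Ψ` preserves morphisms of Frobenius type, linear morphisms, base-isomorphisms, co-angular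
morphisms, pull-back morphisms, isometries and LB-invertible morphisms; and there is an automorphism
`Ψ^{N_{≥1}}` of the monoid `N_{≥1}` with `deg_Fr(Ψ(φ)) = Ψ^{N_{≥1}}(deg_Fr(φ))`, equal to the identity if
`C₁, C₂` admit a non-group-like object (FrdI p. 62). [cite: MochizukiFrdI2008, Thm. 3.4 (iii) p.62] -/
def Thm34iii : Prop :=
  S₁.IsOfStandardType → S₂.IsOfStandardType → HypB S₁ S₂ Ψ →
    (PreservesMor Ψ.functor S₁.IsFrobeniusType S₂.IsFrobeniusType ∧
      PreservesMor Ψ.functor S₁.IsLinear S₂.IsLinear ∧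
      PreservesMor Ψ.functor S₁.IsBaseIso S₂.IsBaseIso ∧
      PreservesMor Ψ.functor S₁.IsCoAngular S₂.IsCoAngular ∧
      PreservesMor Ψ.functor S₁.IsPullbackMorphism S₂.IsPullbackMorphism ∧
      PreservesMor Ψ.functor S₁.IsIsometry S₂.IsIsometry ∧
      PreservesMor Ψ.functor S₁.IsLBInvertible S₂.IsLBInvertible) ∧
    ∃ ΨN : ℕ+ ≃* ℕ+, (∀ ⦃A B : C₁⦄ (φ : A ⟶ B), S₂.degFr (Ψ.functor.map φ) = ΨN (S₁.degFr φ)) ∧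
      ((∃ A : C₁, ¬ S₁.IsGroupLikeObj A) → (∃ A : C₂, ¬ S₂.IsGroupLikeObj A) → ΨN = MulEquiv.refl ℕ+)

/-- **Theorem 3.4 (iii)**, perfection square: under the same hypotheses there is a `1`-unique
`Ψ^pf : C₁^pf ⥤ C₂^pf` with `Ψ^pf ∘ (C₁ → C₁^pf) ≅ (C₂ → C₂^pf) ∘ Ψ`, the perfections being those of
Prop. 3.2 (i) (parameters `P_i : PerfectionData S_i`); if `D₁, D₂` are slim the composite functors are
rigid (FrdI p. 62). [cite: MochizukiFrdI2008, Thm. 3.4 (iii) p.62] -/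
def Thm34iii_pf (P₁ : PerfectionData S₁) (P₂ : PerfectionData S₂) : Prop :=
  S₁.IsOfStandardType → S₂.IsOfStandardType → HypB S₁ S₂ Ψ →
    ∃ Ψpf : P₁.Pf ⥤ P₂.Pf, OneUniqueSquare Ψ.functor P₁.toPf P₂.toPf Ψpf ∧
      (IsSlim D₁ → IsSlim D₂ → IsRigidFunctor (Ψ.functor ⋙ P₂.toPf) ∧ IsRigidFunctor (P₁.toPf ⋙ Ψpf))

/-- **Theorem 3.4 (iv)**, preservation part: under (a), (b) and (c) `D₁, D₂` Frobenius-slim, `Ψ` preserves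
the submonoids `O^▷(-)` and `O^×(-)`, and `Ψ^{N_{≥1}}` is the identity (FrdI pp. 62–63).
[cite: MochizukiFrdI2008, Thm. 3.4 (iv) p.63] -/
def Thm34iv : Prop :=
  S₁.IsOfStandardType → S₂.IsOfStandardType → HypB S₁ S₂ Ψ → IsFrobeniusSlim D₁ → IsFrobeniusSlim D₂ →
    (∀ (A : C₁) (α : End A), α ∈ S₁.endSubmonoid A → Ψ.functor.map α ∈ S₂.endSubmonoid (Ψ.functor.obj A)) ∧
      (∀ (A : C₁) (α : Aut A), α ∈ S₁.unitsSubgroup A → Ψ.functor.mapIso α ∈ S₂.unitsSubgroup (Ψ.functor.obj A)) ∧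
      PreservesDegFr S₁ S₂ Ψ

/-- **Theorem 3.4 (iv)**, unit-trivialisation square: under the same hypotheses there is a `1`-unique
`Ψ^un-tr : C₁^un-tr ⥤ C₂^un-tr` with `Ψ^un-tr ∘ (C₁^istr → C₁^un-tr) ≅ (C₂^istr → C₂^un-tr) ∘ Ψ^istr`, where
`Ψ^istr` is the functor of (i) (a parameter here) and the vertical arrows are the natural functors of
Prop. 3.3 (iii); if `D₁, D₂` are slim the composite functors are rigid (FrdI p. 63).
[cite: MochizukiFrdI2008, Thm. 3.4 (iv) p.63] -/
def Thm34iv_untr (Ψistr : S₁.Istr ⥤ S₂.Istr) : Prop :=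
  S₁.IsOfStandardType → S₂.IsOfStandardType → HypB S₁ S₂ Ψ → IsFrobeniusSlim D₁ → IsFrobeniusSlim D₂ →
    ∃ Ψuntr : S₁.Untr ⥤ S₂.Untr, OneUniqueSquare Ψistr S₁.toUntr S₂.toUntr Ψuntr ∧
      (IsSlim D₁ → IsSlim D₂ → IsRigidFunctor (Ψistr ⋙ S₂.toUntr) ∧ IsRigidFunctor (S₁.toUntr ⋙ Ψuntr))

/-- **Theorem 3.4 (v)**: under (a), (b) and (c) `D₁, D₂` slim, `Ψ` preserves the base-identity
endomorphisms and base-equivalent pairs of co-objective morphisms, and there is a `1`-unique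
`Ψ^Base : D₁ ⥤ D₂` with `Ψ^Base ∘ Base₁ ≅ Base₂ ∘ Ψ` (`1`-commutative; horizontal arrows equivalences);
each composite functor of the square is rigid (FrdI p. 63). [cite: MochizukiFrdI2008, Thm. 3.4 (v) p.63] -/
def Thm34v : Prop :=
  S₁.IsOfStandardType → S₂.IsOfStandardType → HypB S₁ S₂ Ψ → IsSlim D₁ → IsSlim D₂ →
    (∀ (A : C₁) (α : A ⟶ A), S₁.IsBaseIdentity α → S₂.IsBaseIdentity (Ψ.functor.map α)) ∧
      PreservesRel Ψ.functor (fun ⦃_ _⦄ φ ψ => S₁.BaseEquivalent φ ψ) (fun ⦃_ _⦄ φ ψ => S₂.BaseEquivalent φ ψ) ∧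
      ∃ ΨBase : D₁ ⥤ D₂, OneUniqueSquare Ψ.functor S₁.base S₂.base ΨBase ∧
        IsRigidFunctor (Ψ.functor ⋙ S₂.base) ∧ IsRigidFunctor (S₁.base ⋙ ΨBase)

/-- **Remark 3.4.1**: if `C₁, C₂` are of group-like and quasi-isotropic type and `Ψ` and some
quasi-inverse preserve Frobenius degrees, then they preserve base-isomorphisms (FrdI p. 69).
[cite: MochizukiFrdI2008, Rem. 3.4.1 p.69] -/
def Remark341 : Prop :=
  S₁.IsOfGroupLikeType → S₂.IsOfGroupLikeType → S₁.IsOfQuasiIsotropicType → S₂.IsOfQuasiIsotropicType →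
    PreservesDegFr S₁ S₂ Ψ → PreservesDegFr S₂ S₁ Ψ.symm →
      PreservesMor Ψ.functor S₁.IsBaseIso S₂.IsBaseIso ∧ PreservesMor Ψ.inverse S₂.IsBaseIso S₁.IsBaseIso

/-! ### Proposition 3.11 (Frobenioids of isotropic, unit-trivial and group-like type) -/

/-- The setting of Prop. 3.11 for one Frobenioid: `Φ` is the zero monoid ("all of whose values are
monoids of cardinality one"), `D` is of FSMFF-type, and `C` is of isotropic, unit-trivial and group-like
type (FrdI p. 73). [cite: MochizukiFrdI2008, Prop. 3.11 p.73] -/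
@[mk_iff] structure Prop311Setting {C : Type*} [Category C] {D : Type*} [Category D]
    (S : PreFrobenioidData C D) : Prop where
  /-- `Φ = 0` -/
  zero : ∀ (X : D) (x : S.Mon X), x = 1
  /-- `D` of FSMFF-type -/
  fsmff : IsOfFSMFFType D
  /-- `C` of isotropic type -/
  isotropic : S.IsOfIsotropicType
  /-- `C` of unit-trivial type -/
  unitTrivial : S.IsOfUnitTrivialType
  /-- `C` of group-like type -/
  groupLike : S.IsOfGroupLikeType

/-- **Proposition 3.11 (i)**: the functor `C → F_Φ` is an equivalence of categories (FrdI p. 73). With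
`Φ = 0`, `Hom_{F_Φ}(A, B) = Hom_D(Base A, Base B) × N_{≥1}`, so this unfolds to: an arrow is determined by
`(Base, deg_Fr)`; every pair `(f, n)` is realised; every object of `D` is isomorphic to some `Base A`.
[cite: MochizukiFrdI2008, Prop. 3.11 (i) p.73] -/
def Prop311i {C : Type*} [Category C] {D : Type*} [Category D] (S : PreFrobenioidData C D) : Prop :=
  Prop311Setting S →
    (∀ ⦃A B : C⦄ (φ ψ : A ⟶ B), S.base.map φ = S.base.map ψ → S.degFr φ = S.degFr ψ → φ = ψ) ∧
      (∀ (A B : C) (f : S.base.obj A ⟶ S.base.obj B) (n : ℕ+),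
        ∃ φ : A ⟶ B, S.base.map φ = f ∧ S.degFr φ = n) ∧
      ∀ X : D, ∃ A : C, Nonempty (S.base.obj A ≅ X)

/-- **Proposition 3.11 (ii)**: `Ψ` preserves base-isomorphisms, pull-back morphisms, linear morphisms
and morphisms of Frobenius type (FrdI p. 73). [cite: MochizukiFrdI2008, Prop. 3.11 (ii) p.73] -/
def Prop311ii : Prop :=
  Prop311Setting S₁ → Prop311Setting S₂ →
    PreservesMor Ψ.functor S₁.IsBaseIso S₂.IsBaseIso ∧
      PreservesMor Ψ.functor S₁.IsPullbackMorphism S₂.IsPullbackMorphism ∧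
      PreservesMor Ψ.functor S₁.IsLinear S₂.IsLinear ∧
      PreservesMor Ψ.functor S₁.IsFrobeniusType S₂.IsFrobeniusType

/-- **Proposition 3.11 (iii)**: if `Ψ` and some quasi-inverse preserve base-identity endomorphisms,
there is a `1`-unique `Ψ^Base : D₁ ⥤ D₂` `1`-commuting with the projections; if `D₁, D₂` are slim each
composite functor is rigid (FrdI p. 73). [cite: MochizukiFrdI2008, Prop. 3.11 (iii) p.73] -/
def Prop311iii : Prop :=
  Prop311Setting S₁ → Prop311Setting S₂ →
    (∀ (A : C₁) (α : A ⟶ A), S₁.IsBaseIdentity α → S₂.IsBaseIdentity (Ψ.functor.map α)) →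
    (∀ (A : C₂) (α : A ⟶ A), S₂.IsBaseIdentity α → S₁.IsBaseIdentity (Ψ.inverse.map α)) →
      ∃ ΨBase : D₁ ⥤ D₂, OneUniqueSquare Ψ.functor S₁.base S₂.base ΨBase ∧
        (IsSlim D₁ → IsSlim D₂ → IsRigidFunctor (Ψ.functor ⋙ S₂.base) ∧ IsRigidFunctor (S₁.base ⋙ ΨBase))

end PreFrobenioidData

end Literature.AlgebraicGeometry.Frobenioids
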